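import Mathlib
import Literature.Analysis.FluidPDE.Tao2016AveragedNS.ShiftSetCascadeFlows
import Literature.Analysis.FluidPDE.Tao2016AveragedNS.ShiftSetCascadeFlux
import Summits.NavierStokesRegularity.NavierStokesRegularity.Theorems.TaoLadderRungTwoFlatMirrorTableDefs
import Summits.NavierStokesRegularity.NavierStokesRegularity.Theorems.TaoLadderRungTwoFlatPulseDefs
import Summits.NavierStokesRegularity.NavierStokesRegularity.Theorems.TaoLadderRungTwoFlatGaugeGronwall
import Summits.NavierStokesRegularity.NavierStokesRegularity.Theorems.TaoLadderRungTwoFlatNonlinearHop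
import Summits.NavierStokesRegularity.NavierStokesRegularity.Theorems.TaoLadderRungTwoFlatHopRenormalisation
import HarnessLib

/-!
# ONE VALIDATED HOP NEAR A PULSE of the λ₀ = 1 mirror lattice: a linearised hop contraction with explicit gauge data
  (the body of (S2) `MirrorPulse.LinearisedHopContraction`) sends the tube around the pulse into the tube around the
  RESCALED, REPHASED pulse, radius `ρB + O(B² + B̃²)`
  (helper for item stmt-NavierStokesRegularity-22987 `FlatGapCertificatesV2`, crux K_A♭ of route TaoLadderRungTwoFlat;
  cell harvest/h2-tao-ladder, p1 g20 — the λ₀ = 1 instance of lemma L3 of the analytic lane, LADDER §47.3)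

`…HopRenormalisation.hop_renormalisation` specialised to `𝕊 = S♭`, `α = mirrorTable ε ε`, reference `W = Φ` a
shift-periodic exact solution (`IsGlobalSol`, `IsShiftPeriodic τ`), horizon `T = Nτ`, hop `N`: by shift-periodicity
`Φ_{i,k+N}(Nτ + h) = Φ_{i,k}(h)` (`isShiftPeriodic_iterate`), so the re-normalised reference state read in the co-moving
frame is `κ·Φ(h)` — the phase-`h/κ` state of the family member `κΦ(κ·)` (`FlowSymmetry.scaleFam κ Φ`):

* `MirrorPulse.pulse_hop` — **for a bounded exact solution `X` with `ω|X(0) − Φ(0)| ≤ B` (contraction gauge) and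
  `w|X(0) − Φ(0)| ≤ B̃` (admissible gauge), after `N` hops read `N` shells up:
  `ω_{i,k}|X_{i,k+N}(Nτ) − κΦ_{i,k}(h)| ≤ ρB + Γ(‖T♭‖₁A(B̃e^{L'Nτ})²Nτe^{L'Nτ} + 12C²B²‖T♭‖₁²A²M_w³)`
  for some `|κ − 1| ≤ CB`, `|h| ≤ 2CB`** (gauge hypotheses: `ω`, `w` window-regular with `Λ`, `w` window-admissible with
  `A`, `ω_{i,k} ≤ Γw_{i,k+N}`, `w|Φ| ≤ M_w` on `[Nτ−1, Nτ+1]`; `CB ≤ ½`).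

With the contraction gauge growing geometrically ahead and decaying behind (cell screens P-p1g19-T1/T2: `ρ ≈ 0.57` for
`(g,b) = (4,2)`), this is the one-hop tube invariance from which the K_A♭ reference set is built by forward closure
(theory-1 LADDER §47.5 `RobustHoppingOn`); the `O(B̃²)` term is where behind-junk control (L8) enters.

HONEST FRAMING: a conditional perturbation lemma about a MODEL lattice — no pulse is constructed and no contraction is
certified here; nothing about the Navier–Stokes equations.
-/

noncomputable section

-- the sub-problem namespace repeats the summit name by design (D-0017)
set_option linter.dupNamespace false

namespace Summit.NavierStokesRegularity.NavierStokesRegularity.Theorems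

open Set Filter Literature.Analysis.FluidPDE Literature.Analysis.FluidPDE.TaoCascade
open scoped Topology

namespace MirrorPulse

open QuadPolar

/-- **ONE VALIDATED HOP NEAR A SHIFT-PERIODIC PULSE (λ₀ = 1).** See the module docstring; `T♭ = mirrorTable ε ε`,
`L' = 2‖T♭‖₁MΛ`. [cite: Tao2016AveragedNS, §4 (4.8) and §6.3–6.4 (statement shape of a hop certificate); route TaoLadderRungTwoFlat, analytic lane L3 at λ₀ = 1] -/
theorem pulse_hop {ε τ : ℝ} {Φ X : Fin 2 → ℤ → ℝ → ℝ} {ω w : Fin 2 → ℤ → ℝ} {Λ A Γ M Mw ρ C B B' : ℝ} {N : ℕ}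
    (hΦ : IsGlobalSol ε Φ) (hper : IsShiftPeriodic τ Φ) (hτ : 0 ≤ τ) (hX : IsGlobalSol ε X)
    (hΦb : ∀ i n t, |Φ i n t| ≤ M) (hXb : ∀ i n t, |X i n t| ≤ M)
    (hω : IsWindowRegular ω Λ) (hw : IsWindowRegular w Λ) (hA : IsWindowAdmissible w A)
    (hΓ : ∀ i k, ω i k ≤ Γ * w i (k + N)) (hMw : 0 ≤ Mw)
    (hΦg : ∀ j k, ∀ t ∈ Icc ((N : ℝ) * τ - 1) ((N : ℝ) * τ + 1), w j k * |Φ j k t| ≤ Mw)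
    (hS2 : ∀ (u : Fin 2 → ℤ → ℝ → ℝ) (B₁ : ℝ), IsVariationalOn ε (N * τ) Φ u →
      (∀ i k, ω i k * |u i k 0| ≤ B₁) →
        ∃ c₁ c₂ : ℝ, |c₁| ≤ C * B₁ ∧ |c₂| ≤ C * B₁ ∧
          ∀ (i : Fin 2) (k : ℤ),
            ω i k * |u i (k + N) (N * τ)
              - c₁ * quadTermOn shiftSetFlat 0 (mirrorTable ε ε) Φ i (k + N) (N * τ)
              - c₂ * Φ i (k + N) (N * τ)| ≤ ρ * B₁)
    (hB : ∀ i k, ω i k * |X i k 0 - Φ i k 0| ≤ B) (hB' : ∀ i k, w i k * |X i k 0 - Φ i k 0| ≤ B')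
    (hCB : C * B ≤ 1 / 2) :
    ∃ κ h : ℝ, |κ - 1| ≤ C * B ∧ |h| ≤ 2 * (C * B) ∧
      ∀ (i : Fin 2) (k : ℤ), ω i k * |X i (k + N) (N * τ) - κ * Φ i k h| ≤
        ρ * B + Γ * (tableAbsSum shiftSetFlat (mirrorTable ε ε) * A *
          (B' * Real.exp (2 * tableAbsSum shiftSetFlat (mirrorTable ε ε) * M * Λ * (N * τ))) ^ 2 * (N * τ) *
            Real.exp (2 * tableAbsSum shiftSetFlat (mirrorTable ε ε) * M * Λ * (N * τ)) +
          12 * (C * B) ^ 2 * ((tableAbsSum shiftSetFlat (mirrorTable ε ε)) ^ 2 * A ^ 2 * Mw ^ 3)) := by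
  have hT : 0 ≤ (N : ℝ) * τ := by positivity
  -- the (S2) body in the shape consumed by `hop_renormalisation` (hop `N : ℤ`, horizon `T = Nτ`)
  have hlin : ∀ u : Fin 2 → ℤ → ℝ → ℝ,
      (∀ i n t, HasDerivAt (u i n) (linTermOn shiftSetFlat 0 (mirrorTable ε ε) Φ u i n t) t) →
      (∃ Mu : ℝ, ∀ i n, ∀ t ∈ Icc 0 ((N : ℝ) * τ), |u i n t| ≤ Mu) → (∀ i k, ω i k * |u i k 0| ≤ B) →
        ∃ c₁ c₂ : ℝ, |c₁| ≤ C * B ∧ |c₂| ≤ C * B ∧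
          ∀ i k, ω i k * |u i (k + (N : ℤ)) ((N : ℝ) * τ)
            - c₁ * quadTermOn shiftSetFlat 0 (mirrorTable ε ε) Φ i (k + (N : ℤ)) ((N : ℝ) * τ)
            - c₂ * Φ i (k + (N : ℤ)) ((N : ℝ) * τ)| ≤ ρ * B := by
    intro u hud hub hBu
    exact hS2 u B ⟨hud, hub⟩ hBu
  obtain ⟨κ, h, hκ, hh, hest⟩ := hop_renormalisation isNearestNeighbourSet_shiftSetFlat (mirrorTable ε ε) hw hA
    (fun i k => (hω.1 i k).le) (N := (N : ℤ)) hΓ hT hMw hΦ hX hΦb hXb hΦg hlin hB hB' hCB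
  refine ⟨κ, h, hκ, hh, fun i k => ?_⟩
  have hshift : Φ i (k + (N : ℤ)) ((N : ℝ) * τ + h) = Φ i k h := by
    rw [add_comm ((N : ℝ) * τ) h]
    exact isShiftPeriodic_iterate hper N i k h
  have h1 := hest i k
  rw [hshift] at h1
  exact h1

end MirrorPulse

end Summit.NavierStokesRegularity.NavierStokesRegularity.Theorems

end
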